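import Literature.Geometry.Lorentzian.KerrLocalEnergyDecay
import Literature.Geometry.Lorentzian.KerrWaveDecay
import HarnessLib

/-!
# Integrated local energy decay on subextremal Kerr: the Dafermos–Rodnianski–Shlapentokh-Rothman
# Theorem 3.2 (25) for admissible hypersurfaces, and gr.S24 integrated decay from the printed
# theorem alone

(family `gr`, statement group **gr.S24**; namespace `Literature.Geometry.Lorentzian`)

`KerrWaveDecay.lean` vendors the named fact `drsr_wave_integrated_decay_kerr`: for `|a| < M` and
every coordinate radius `R` there is `C = C(M, a, R) < ∞`, uniform in `ψ`, with
`∫₀^∞ E_loc(τ, R) dτ ≤ C · E₂[ψ](0)` for every admissible wave `ψ` (`IsAdmissibleKerrWave`: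
smooth solution of `□_g ψ = 0` on the ingoing Kerr–Schild exterior chart `{r > r₊}` with data
compactly supported in the open leaf `{t*_KS = 0, r > r₊}`), `E_loc` the local coordinate energy
through the Kerr–Schild leaves `{t*_KS = τ} ∩ {‖y‖ ≤ R}` and `E₂[ψ](0) = sliceSobolevEnergy … ψ 0 2
0 univ` the second-order coordinate energy of the data. Its docstring calls this the *local
consequence* of Dafermos–Rodnianski–Shlapentokh-Rothman (DRSR), *Decay for solutions of the wave
equation on Kerr exterior spacetimes III*, arXiv:1402.7034 = Ann. of Math. 183 (2016), Thm. 3.2,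
estimate (25) with `j = 2`, and lists (module docstring of `KerrWaveDecay.lean`, *Design choices*,
(i)–(v)) the standard identifications this consequence needs **in addition** to the printed
theorem, because the Kerr–Schild leaves are not admissible hypersurfaces of DRSR (they bend
logarithmically to the past at spatial infinity; module docstring of `KerrWaveEnergy.lean`): finite
speed of propagation, the time translation to an admissible hypersurface in the future of the
initial leaf, and — for the constant to be uniform in `ψ` — the `J^T` energy identity in the far
region for `ψ` and for `Tψ`.

This file makes that reduction explicit and machine-checked, in exact parallel with the treatment
of boundedness (Thm. 3.1 (23)) in `KerrWaveEnergy.lean` / `KerrWaveEnergyProofs.lean`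
(`DafermosRodnianskiShlapentokhRothman2016_energyBoundedness`, `drsr_wave_boundedness_kerr_of_DRSR`):

* `DafermosRodnianskiShlapentokhRothman2016_integratedDecay` (**named fact**, D-0014): DRSR
  Thm. 3.2 (25) with `j = 2`, `δ = 1`, `a₀ = |a|`, in the generalised form of their §3.3 (p. 14 of
  the arXiv text: "Theorems 3.1 and 3.2 hold where `Σ₀` is replaced by an arbitrary admissible
  hypersurface `Σ̃₀` …, `𝓡₀` … redefined as `D⁺(Σ̃₀)` …, and `N` is kept as is"), for the
  Kerr–Schild graphs `Σ̃₀ = {t*_KS = F(y)}` of admissible height functions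
  (`Kerr.IsAdmissibleHeight`, `KerrWaveEnergy.lean`) which are **flat on a ball** `{‖y‖ ≤ ρ}`
  (`F = 0` there, so that `Σ̃₀` is the initial Kerr–Schild leaf near the black hole), written as
  its local first-order consequence with every term expressed through the prelude's coordinate
  energies (below);
* `drsr_wave_integrated_decay_kerr_of_DRSR` (**proved**):
  `DafermosRodnianskiShlapentokhRothman2016_integratedDecay → drsr_wave_integrated_decay_kerr`.
  The far-region `J^T` energy identity (`kerr_far_TEnergy_comparison_of_farRadius_le`), the
  coarse finite speed of propagation (`kerr_far_finite_speed_of_propagation`, both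
  `KerrWaveEnergyProofs.lean`) and the commutation with `T = ∂_{t*}`
  (`IsAdmissibleKerrWave.timeDeriv`, `KerrTimeDerivative.lean`) are theorems, so **gr.S24
  integrated decay now rests on the printed Theorem 3.2 alone**; composed with
  `drsr_wave_local_energy_decay_kerr_of_integrated_decay` (`KerrLocalEnergyDecay.lean`) this gives
  `drsr_wave_local_energy_decay_kerr_of_DRSR25`: the qualitative gr.S24 statement
  `E_loc(τ, R) → 0` of `BlackHoles.lean` from the printed Theorem 3.2 alone (no `r^p` method, no
  Corollary 3.1);
* auxiliary, proved: the coordinate energy density is at most `4 ‖Dψ̃‖²`, and that of `Tψ` at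
  most `4 ‖D²ψ̃‖²` (`coordEnergyDensity_le_four_mul_norm_fderiv_sq`,
  `coordEnergyDensity_timeDeriv_le`), whence `sliceEnergy ψ ≤ 4 E_{k+1}[ψ]` and
  `sliceEnergy (Tψ) ≤ 4 E_{k+2}[ψ]` (`sliceEnergy_le_four_mul_sliceSobolevEnergy`,
  `sliceEnergy_timeDeriv_le_four_mul_sliceSobolevEnergy`).

## The printed estimate and its vendored consequence

DRSR Thm. 3.2 (p. 13–14): for `M > 0`, `0 ≤ a₀ < M`, `δ > 0`, `j ≥ 1` there is
`C = C(a₀, M, δ, j)` such that for `|a| ≤ a₀` and all sufficiently regular solutions of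
`□_{g_{a,M}} ψ = 0` on `𝓡₀ = D⁺(Σ₀)`,
`∫_{𝓡₀} r^{-1-δ} ζ ∑_{1≤i₁+i₂+i₃≤j} |∇̸^{i₁}T^{i₂}(Z̃*)^{i₃}ψ|² + r^{-1-δ} ∑_{1≤i₁+i₂+i₃≤j−1}
(|∇̸^{i₁}T^{i₂}(Z̃*)^{i₃+1}ψ|² + |∇̸^{i₁}T^{i₂}(Z*)^{i₃}ψ|²) ≤ C ∫_{Σ₀} ∑_{0≤i≤j−1} J^N_μ[N^iψ] n^μ_{Σ₀}`
(25). Here (§2.1.2) `Z*` is the smooth extension to `𝓡 ⊃ 𝓗⁺` of the Kerr-star coordinate vector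
field `∂_r`, `Z̃* = χZ + (1 − χ)Z*` and `ζ` (§2.2.3) degenerate only at trapping, and `N` (footnote
to §3.1: "we can alternatively take `N` to be the vector field of Proposition 4.5.1; this is the
vector field we shall use in the proof") is `φ_τ`-invariant, timelike on `𝓡` including `𝓗⁺`, and
**equal to `T` for `r ≥ r₁(a, M)`** (Prop. 4.5.1). For `j = 2` the second line of (25) contains
`r^{-1-δ}(|∇̸ψ|² + |Tψ|² + |Z*ψ|²)` with **no** `ζ`: at first order the estimate does not
degenerate (trapping costs exactly one derivative, consistent with Sbierski's obstruction
`Literature.Barriers.FinalStateConjecture.SbierskiTrappingObstruction`), and since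
`(T, Z*, ∂_{θ*}, ∂_{φ*})` is the regular Kerr-star coordinate frame on `𝓡`, this line dominates
`c(M, a, R) ∑_μ (∂_μψ̃)²` (Kerr–Schild Cartesian derivatives) on `{r ≤ R}`.

**Vendored consequence** (`DafermosRodnianskiShlapentokhRothman2016_integratedDecay`). Take
`Σ̃₀ = {t*_KS = F(y)}` with `F` admissible and `F = 0` on `{‖y‖ ≤ ρ}`, `ρ ≥ R₀(M, a)`, `R ≤ ρ`:
* LHS ⊇ the integral over `{t*_KS > 0, ‖y‖ ≤ R, r > r₊} ⊆ D⁺(Σ̃₀) ∩ {r ≤ R}` (`F = 0` on the ball,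
  `r ≤ ‖y‖`, `Kerr.radius_le_spatialNorm`), where `dVol = dt*_KS d³y` (`det g = −1`) and the
  integrand is `≥ c ∑_μ(∂_μψ̃)²`: this is `c ∫₀^∞ localSliceEnergy ψ τ R dτ` (Tonelli);
* RHS, near part `Σ̃₀ ∩ {‖y‖ ≤ ρ} = {t*_KS = 0} ∩ {‖y‖ ≤ ρ}`: `(J^N[ψ] + J^N[Nψ]) · n dσ ≤
  C(M, a, ρ) ∑_{|α|≤2} |∂^αψ̃|² dy` (`N`, `n_{Σ̃₀}` smooth up to `𝓗⁺` and `φ_τ`-invariant, hence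
  with bounded Kerr–Schild components and first derivatives on `{r₊ < r, ‖y‖ ≤ ρ}`), i.e. at most
  `C · sliceSobolevEnergy … ψ 0 2 0 (closedBall 0 ρ)`;
* RHS, far part `Σ̃₀ ∩ {‖y‖ > ρ}`: there `r ≥ √(ρ² − a²) ≥ r₁` once `ρ ≥ R₀ := √(r₁² + a²) + 1`, so
  `N = T`, `Nψ = Tψ = ∂_{t*}ψ̃` (`timeDeriv`), and the `J^T`-flux densities of `ψ`, `Tψ` through the
  graph w.r.t. `dy` are `≤ C(M, a) ∑_μ(∂_μ ·)²` (`T = (1,0,0,0)`, conormal `dt* − dF` with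
  `|dF| ≤ 1`, `0 ≤ 2H ≤ 2M/r₊`): at most `C · (graphSliceEnergyOn … ψ F 0 {ρ < ‖y‖} +
  graphSliceEnergyOn … (timeDeriv ψ) F 0 {ρ < ‖y‖})`.
Each step weakens, so the vendored `Prop` is implied by the printed theorem; the existential `R₀`
reflects that `r₁(a, M)` of Prop. 4.5.1 is not printed in closed form. As for (23) in
`KerrWaveEnergy.lean`, the class of solutions is `IsAdmissibleKerrWaveOn M a F` (smooth solutions
on the exterior chart with data compactly supported on the open graph), which on
`D⁺(Σ̃₀) ∩ {r > r₊}` coincide with DRSR's solutions of the zero-extended data (§4.1;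
arXiv:1010.5132, Prop. 4.5.1).

## The reduction

Given `R`, put `λ = max (4A, 4Ms, R_far(M, a), R₀, R)` (`A = 4MB + 2M`, `B` a bound for
`|heightProfile'|` on `[0, 2]`, `s` the coarse propagation speed) and `F = heightFn M λ`
(`KerrWaveEnergy.lean`: `F = 0` on `{‖y‖ ≤ λ}`, `F = 2M log ‖y‖ − 2M log λ` far out, slope
`≤ 1/4`, `0 ≤ sF ≤ ‖y‖/2`, admissible). For an admissible wave `φ` with data supported in
`{‖x⃗‖ ≤ ρ}`: finite speed of propagation makes `φ, dφ` vanish on `{x⁰ ≥ 0, ‖x⃗‖ > ρ + s x⁰}`, so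
`φ` has compactly supported data on the graph of `F` and vanishes on the wedge
`{0 ≤ x⁰ ≤ F(x⃗)}` beyond `‖x⃗‖ = 2ρ + 1`; the far `J^T` identity then gives
`E^far_F[φ](0) ≤ 8 E^far_0[φ](0) ≤ 8 sliceEnergy φ 0`. Apply this to `φ = ψ` and to `φ = Tψ`
(again admissible, `IsAdmissibleKerrWave.timeDeriv`), and bound `sliceEnergy ψ 0 ≤ 4 E₂[ψ](0)`,
`sliceEnergy (Tψ) 0 ≤ 4 E₂[ψ](0)`, `E₂(ball) ≤ E₂(univ)`: the fact's right-hand side is at most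
`65 · E₂[ψ](0)`, its left-hand side is the target's. Constant `65 C(M, a, F_λ, λ, R)`, depending
on `(M, a, R)` only.

## Design choices

* The fact is stated for graphs flat on a ball (a subclass of the admissible hypersurfaces of the
  first kind of arXiv:1010.5132, Def. 4.1, transcribed as `Kerr.IsAdmissibleHeight`) because only
  for these is every term of (25) expressible by quantities the prelude has (coordinate energies of
  `WeightedNorms.lean`, `Sweep2.lean`, `KerrWaveEnergy.lean`; `timeDeriv`); no red-shift field `N`,
  no frame `(T, Z*, ∇̸)` and no hyperboloidal leaves are constructed. Restricting the class of
  hypersurfaces and dominating one-sidedly only weakens the printed statement.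
* The second-order term is kept on the flat part only. On the bent far part the printed right-hand
  side is first order in `ψ` and `Tψ` (`N = T` there), which is what makes the reduction
  elementary: a second-order energy comparison between the leaf `{t*_KS = 0}` and the
  logarithmically bent graph is never needed.
* Nothing here duplicates Mathlib (no Lorentzian wave equations there).

## References

* M. Dafermos, I. Rodnianski, Y. Shlapentokh-Rothman, *Decay for solutions of the wave equation
  on Kerr exterior spacetimes III: the full subextremal case `|a| < M`*, Ann. of Math. 183 (2016)
  787–913, arXiv:1402.7034: §2.1.2 (`Z*`), §2.2.3 (`ζ`, `Z̃*`), §2.2.6 (volume form), §3.1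
  (footnote on `N`; display after (23)), §3.2 Thm. 3.2 (25), §3.3 (admissible `Σ̃₀`, p. 14), §4.1,
  Prop. 4.5.1 (`N = T` for `r ≥ r₁`) (key `DafermosRodnianskiShlapentokhrothman2014`).
* M. Dafermos, I. Rodnianski, *Decay for solutions of the wave equation on Kerr exterior
  spacetimes I–II: the cases `|a| ≪ M` or axisymmetry*, arXiv:1010.5132, §4.4 Def. 4.1, Prop.
  4.5.1, §4.6 Prop. 4.6.1 (key `DafermosRodnianski2010KerrSmallA`).
* J. Sbierski, *Characterisation of the energy of Gaussian beams on Lorentzian manifolds: with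
  applications to black hole spacetimes*, Anal. PDE 8 (2015), Thm. 7.4 (the derivative loss is
  necessary).
-/

noncomputable section

open Set Filter MeasureTheory Metric TopologicalSpace
open scoped Topology ENNReal Manifold ContDiff

namespace Literature.Geometry.Lorentzian

/-! ### Coordinate energy densities below the Sobolev integrands -/

/-- `∑_μ (∂_μψ̃)² ≤ 4 ‖Dψ̃‖²`: each coordinate derivative is the Fréchet derivative applied to a unit
vector. [folklore] -/
theorem coordEnergyDensity_le_four_mul_norm_fderiv_sq (U : Opens E4) (ψ : U → ℝ) (x : E4) :
    coordEnergyDensity U ψ x ≤ 4 * ‖fderiv ℝ (Function.extend Subtype.val ψ 0) x‖ ^ 2 := by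
  set L := fderiv ℝ (Function.extend Subtype.val ψ (0 : E4 → ℝ)) x with hL
  have h : ∀ μ : Fin 4, (L (EuclideanSpace.single μ (1 : ℝ))) ^ 2 ≤ ‖L‖ ^ 2 := by
    intro μ
    have h1 := L.le_opNorm (EuclideanSpace.single μ (1 : ℝ))
    rw [show ‖EuclideanSpace.single μ (1 : ℝ)‖ = 1 by simp, mul_one, Real.norm_eq_abs] at h1
    exact sq_le_sq' (abs_le.mp h1).1 (abs_le.mp h1).2
  calc coordEnergyDensity U ψ x = ∑ μ : Fin 4, (L (EuclideanSpace.single μ (1 : ℝ))) ^ 2 := rfl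
    _ ≤ ∑ _μ : Fin 4, ‖L‖ ^ 2 := Finset.sum_le_sum fun μ _ ↦ h μ
    _ = 4 * ‖L‖ ^ 2 := by simp

/-- **The energy density of `Tψ` is at most `4 ‖D²ψ̃‖²`** at points of `U`, for smooth `ψ`:
`∂_μ(Tψ) = D²ψ̃(e_μ, e₀)` (`fderiv_extend_timeDeriv`, `fderiv_partial_eq_flip`). [folklore] -/
theorem coordEnergyDensity_timeDeriv_le {U : Opens E4} {ψ : U → ℝ}
    (hψ : ContMDiff 𝓘(ℝ, E4) 𝓘(ℝ, ℝ) ∞ ψ) (x : U) :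
    coordEnergyDensity U (timeDeriv ψ) x ≤
      4 * ‖iteratedFDeriv ℝ 2 (Function.extend Subtype.val ψ 0) x‖ ^ 2 := by
  set Φ := Function.extend Subtype.val ψ (0 : E4 → ℝ) with hΦ
  have hΦ2 : ContDiffAt ℝ 2 Φ x := (contDiffAt_extend hψ x).of_le (by norm_cast)
  have hD : fderiv ℝ (Function.extend Subtype.val (timeDeriv ψ) 0) x =
      (fderiv ℝ (fderiv ℝ Φ) x).flip (E4.basisVector 0) := by
    rw [fderiv_extend_timeDeriv ψ x, fderiv_partial_eq_flip hΦ2]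
  have hnorm : ‖fderiv ℝ (fderiv ℝ Φ) x‖ = ‖iteratedFDeriv ℝ 2 Φ x‖ := by
    rw [← norm_iteratedFDeriv_fderiv, norm_iteratedFDeriv_one]
  have hflip : ‖(fderiv ℝ (fderiv ℝ Φ) x).flip (E4.basisVector 0)‖ ≤ ‖iteratedFDeriv ℝ 2 Φ x‖ := by
    calc ‖(fderiv ℝ (fderiv ℝ Φ) x).flip (E4.basisVector 0)‖
        ≤ ‖(fderiv ℝ (fderiv ℝ Φ) x).flip‖ * ‖E4.basisVector 0‖ :=
          ContinuousLinearMap.le_opNorm _ _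
      _ = ‖iteratedFDeriv ℝ 2 Φ x‖ := by
          rw [ContinuousLinearMap.opNorm_flip, show ‖E4.basisVector 0‖ = 1 by simp, mul_one, hnorm]
  calc coordEnergyDensity U (timeDeriv ψ) x
      ≤ 4 * ‖fderiv ℝ (Function.extend Subtype.val (timeDeriv ψ) 0) x‖ ^ 2 :=
        coordEnergyDensity_le_four_mul_norm_fderiv_sq U _ x
    _ ≤ 4 * ‖iteratedFDeriv ℝ 2 Φ x‖ ^ 2 := by
        rw [hD]
        gcongr

/-- **First-order energy below the Sobolev energy**: `sliceEnergy ψ τ ≤ 4 · E_{k+1}[ψ](τ)`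
(`sliceSobolevEnergy … ψ τ (k + 1) 0 univ`; the `m = 1` term of the Sobolev integrand dominates
`¼ ∑_μ(∂_μψ̃)²`). [folklore] -/
theorem sliceEnergy_le_four_mul_sliceSobolevEnergy (U : Opens E4) (ψ : U → ℝ) (τ : ℝ) (k : ℕ) :
    sliceEnergy U ψ τ ≤ 4 * sliceSobolevEnergy U ψ τ (k + 1) 0 univ := by
  unfold sliceEnergy sliceSobolevEnergy
  rw [Measure.restrict_univ, ← lintegral_const_mul' _ _ (by simp)]
  refine lintegral_mono fun y ↦ ?_
  by_cases hy : E4.ofTimeSpace τ y ∈ U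
  · rw [indicator_of_mem (show y ∈ {y : E3 | E4.ofTimeSpace τ y ∈ U} from hy),
      indicator_of_mem (show y ∈ {y : E3 | E4.ofTimeSpace τ y ∈ U} from hy), Real.rpow_zero,
      one_mul, ← ENNReal.ofReal_ofNat 4, ← ENNReal.ofReal_mul (by norm_num)]
    refine ENNReal.ofReal_le_ofReal ?_
    calc coordEnergyDensity U ψ (E4.ofTimeSpace τ y)
        ≤ 4 * ‖fderiv ℝ (Function.extend Subtype.val ψ 0) (E4.ofTimeSpace τ y)‖ ^ 2 :=
          coordEnergyDensity_le_four_mul_norm_fderiv_sq U ψ _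
      _ = 4 * ‖iteratedFDeriv ℝ 1 (Function.extend Subtype.val ψ 0) (E4.ofTimeSpace τ y)‖ ^ 2 := by
          rw [norm_iteratedFDeriv_one]
      _ ≤ 4 * ∑ m ∈ Finset.range (k + 1 + 1),
            ‖iteratedFDeriv ℝ m (Function.extend Subtype.val ψ 0) (E4.ofTimeSpace τ y)‖ ^ 2 := by
          gcongr
          exact Finset.single_le_sum (f := fun m ↦
            ‖iteratedFDeriv ℝ m (Function.extend Subtype.val ψ 0) (E4.ofTimeSpace τ y)‖ ^ 2)
            (fun m _ ↦ sq_nonneg _) (Finset.mem_range.mpr (by omega))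
  · rw [indicator_of_notMem (show y ∉ {y : E3 | E4.ofTimeSpace τ y ∈ U} from hy),
      indicator_of_notMem (show y ∉ {y : E3 | E4.ofTimeSpace τ y ∈ U} from hy), mul_zero]

/-- **Energy of `Tψ` below the second-order Sobolev energy of `ψ`**:
`sliceEnergy (Tψ) τ ≤ 4 · E_{k+2}[ψ](τ)` for smooth `ψ` (the `m = 2` term dominates,
`coordEnergyDensity_timeDeriv_le`). This is the elementary half of "`∫ J^N[Nψ] n` is controlled by
the `H²`-type energy of the data" (DRSR arXiv:1402.7034, (29)). [folklore] -/
theorem sliceEnergy_timeDeriv_le_four_mul_sliceSobolevEnergy {U : Opens E4} {ψ : U → ℝ}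
    (hψ : ContMDiff 𝓘(ℝ, E4) 𝓘(ℝ, ℝ) ∞ ψ) (τ : ℝ) (k : ℕ) :
    sliceEnergy U (timeDeriv ψ) τ ≤ 4 * sliceSobolevEnergy U ψ τ (k + 2) 0 univ := by
  unfold sliceEnergy sliceSobolevEnergy
  rw [Measure.restrict_univ, ← lintegral_const_mul' _ _ (by simp)]
  refine lintegral_mono fun y ↦ ?_
  by_cases hy : E4.ofTimeSpace τ y ∈ U
  · rw [indicator_of_mem (show y ∈ {y : E3 | E4.ofTimeSpace τ y ∈ U} from hy),
      indicator_of_mem (show y ∈ {y : E3 | E4.ofTimeSpace τ y ∈ U} from hy), Real.rpow_zero,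
      one_mul, ← ENNReal.ofReal_ofNat 4, ← ENNReal.ofReal_mul (by norm_num)]
    refine ENNReal.ofReal_le_ofReal ?_
    calc coordEnergyDensity U (timeDeriv ψ) (E4.ofTimeSpace τ y)
        ≤ 4 * ‖iteratedFDeriv ℝ 2 (Function.extend Subtype.val ψ 0) (E4.ofTimeSpace τ y)‖ ^ 2 :=
          coordEnergyDensity_timeDeriv_le hψ ⟨_, hy⟩
      _ ≤ 4 * ∑ m ∈ Finset.range (k + 2 + 1),
            ‖iteratedFDeriv ℝ m (Function.extend Subtype.val ψ 0) (E4.ofTimeSpace τ y)‖ ^ 2 := by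
          gcongr
          exact Finset.single_le_sum (f := fun m ↦
            ‖iteratedFDeriv ℝ m (Function.extend Subtype.val ψ 0) (E4.ofTimeSpace τ y)‖ ^ 2)
            (fun m _ ↦ sq_nonneg _) (Finset.mem_range.mpr (by omega))
  · rw [indicator_of_notMem (show y ∉ {y : E3 | E4.ofTimeSpace τ y ∈ U} from hy),
      indicator_of_notMem (show y ∉ {y : E3 | E4.ofTimeSpace τ y ∈ U} from hy), mul_zero]

/-! ### The printed theorem: DRSR Thm. 3.2 (25), `j = 2`, for admissible graphs flat on a ball -/

/-- **Dafermos–Rodnianski–Shlapentokh-Rothman, integrated local energy decay with loss of one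
derivative, through admissible hypersurfaces** (arXiv:1402.7034 = Ann. of Math. 183 (2016),
Thm. 3.2, estimate (25), in the generalised form of §3.3, p. 14: "Theorems 3.1 and 3.2 hold where
`Σ₀` is replaced by an arbitrary 'admissible' hypersurface `Σ̃₀` (see Section 4.4 of [dr7] for this
notion), …, `𝓡₀`, `𝓗⁺₀` are redefined as `D⁺(Σ̃₀)`, `D⁺(Σ̃₀) ∩ 𝓗⁺`, respectively, and `N` is kept
as is", proven as Prop. 4.6.1 of arXiv:1010.5132). **As printed**: for `M > 0`, `0 ≤ a₀ < M`,
`δ > 0`, `j ≥ 1` there is `C = C(a₀, M, δ, j)` such that for `|a| ≤ a₀` and all sufficiently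
regular solutions of `□_{g_{a,M}} ψ = 0` on `D⁺(Σ̃₀)`,
`∫_{D⁺(Σ̃₀)} r^{-1-δ} ζ ∑_{1≤i₁+i₂+i₃≤j} |∇̸^{i₁}T^{i₂}(Z̃*)^{i₃}ψ|²
  + r^{-1-δ} ∑_{1≤i₁+i₂+i₃≤j−1} (|∇̸^{i₁}T^{i₂}(Z̃*)^{i₃+1}ψ|² + |∇̸^{i₁}T^{i₂}(Z*)^{i₃}ψ|²)
  ≤ C ∫_{Σ̃₀} ∑_{0≤i≤j−1} J^N_μ[N^iψ] n^μ_{Σ̃₀}` (25),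
where `Z*` is the smooth extension to `𝓡 ⊃ 𝓗⁺` of the Kerr-star coordinate field `∂_r` (§2.1.2),
`ζ`, `Z̃*` degenerate only at trapping (§2.2.3), and `N` is the `φ_τ`-invariant timelike red-shift
vector field of Prop. 4.5.1, with `N = T` for `r ≥ r₁(a, M)` (admissible in the statement by the
footnote to §3.1). For `j = 2` the second line is `r^{-1-δ}(|∇̸ψ|² + |Tψ|² + |Z*ψ|² + ⋯)`, which
does **not** degenerate: integrated local energy decay losing exactly one derivative.
**Vendored form** (weaker; module docstring, *The printed estimate and its vendored consequence*):
for subextremal `(M, a)` (`a₀ := |a|`, `δ := 1`, `j := 2`) there is `R₀ = R₀(M, a) > 0` such that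
for every admissible height function `F` (`Kerr.IsAdmissibleHeight M F`) vanishing on a ball
`{‖y‖ ≤ ρ}` with `ρ ≥ R₀` (so that `Σ̃₀ = {t*_KS = F(y)}` is the Kerr–Schild leaf `{t*_KS = 0}`
over the ball and `N = T` on `Σ̃₀ ∩ {‖y‖ > ρ}`) and every `R ≤ ρ` there is
`C = C(M, a, F, ρ, R) < ∞` such that every smooth solution `ψ` on the exterior chart with data
compactly supported on the open graph (`IsAdmissibleKerrWaveOn M a F ψ`; on `D⁺(Σ̃₀) ∩ {r > r₊}`
it is DRSR's solution of the zero-extended data, §4.1 and arXiv:1010.5132, Prop. 4.5.1) satisfies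
`∫₀^∞ E_loc(τ, R) dτ ≤ C · (E₂[ψ](Σ̃₀ ∩ {‖y‖ ≤ ρ}) + E^far_F[ψ](0) + E^far_F[Tψ](0))`:
on the left the local coordinate energy through the leaves `{t*_KS = τ} ∩ {‖y‖ ≤ R} ⊆ D⁺(Σ̃₀) ∩
{r ≤ R}` (`localSliceEnergy`; the second line of (25) dominates `c(M, a, R) ∑_μ(∂_μψ̃)²` there,
`dVol = dt*_KS d³y` as `det g = −1`, `r ≤ ‖y‖`); on the right the second-order coordinate energy
of the data on the flat part (`sliceSobolevEnergy … ψ 0 2 0 (closedBall 0 ρ)`, dominating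
`∫ (J^N[ψ] + J^N[Nψ]) · n` there since `N`, `n` are smooth up to `𝓗⁺` and `φ_τ`-invariant) and the
first-order coordinate energies of `ψ` and `Tψ = ∂_{t*}ψ̃` (`timeDeriv`) through the far part of
the graph (`graphSliceEnergyOn … F 0 {ρ < ‖y‖}`, dominating `∫ (J^T[ψ] + J^T[Tψ]) · n` there,
where `N = T`). The existential `R₀` (`= √(r₁² + a²) + 1` works, `r² ≥ ‖y‖² − a²`) reflects that
`r₁(a, M)` is not printed in closed form. Not transcribed, as in
`DafermosRodnianskiShlapentokhRothman2016_energyBoundedness`: the clause "for all `|a'| ≤ a₀`" of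
arXiv:1010.5132, Def. 4.1 (i). The 127-page proof (Carter separation, frequency-localised
multiplier estimates, quantitative mode stability, continuity in `a`, red-shift commutation; §3.4)
is not reproduced: this is a named fact (D-0014).
[cite: DafermosRodnianskiShlapentokhrothman2014, Thm. 3.2 (25) with §3.3 (p. 14) and Prop. 4.5.1] -/
def DafermosRodnianskiShlapentokhRothman2016_integratedDecay : Prop :=
  ∀ [Kerr.Facts] [Kerr.SliceFacts] (M a : ℝ), Kerr.IsSubextremal M a →
    ∃ R₀ : ℝ, 0 < R₀ ∧ ∀ (F : E3 → ℝ) (ρ : ℝ), Kerr.IsAdmissibleHeight M F → R₀ ≤ ρ →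
      (∀ y : E3, ‖y‖ ≤ ρ → F y = 0) → ∀ R : ℝ, R ≤ ρ →
      ∃ C : ℝ≥0∞, C < ⊤ ∧ ∀ ψ : Kerr.exterior M a → ℝ, IsAdmissibleKerrWaveOn M a F ψ →
        ∫⁻ τ in Ioi (0 : ℝ), localSliceEnergy (Kerr.exterior M a) ψ τ R ≤
          C * (sliceSobolevEnergy (Kerr.exterior M a) ψ 0 2 0 (closedBall (0 : E3) ρ) +
            graphSliceEnergyOn (Kerr.exterior M a) ψ F 0 {y | ρ < ‖y‖} +
            graphSliceEnergyOn (Kerr.exterior M a) (timeDeriv ψ) F 0 {y | ρ < ‖y‖})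

/-! ### gr.S24 integrated decay from the printed theorem alone -/

/-- **Reduction of gr.S24 integrated local energy decay to the printed theorem.** The named fact
`drsr_wave_integrated_decay_kerr` of `KerrWaveDecay.lean` (`∫₀^∞ E_loc(τ, R) dτ ≤ C(M, a, R) ·
E₂[ψ](0)` for every admissible wave, with a constant uniform in `ψ`) follows from
Dafermos–Rodnianski–Shlapentokh-Rothman's Theorem 3.2 (25) for admissible hypersurfaces
(`DafermosRodnianskiShlapentokhRothman2016_integratedDecay`) alone. Proof (module docstring, *The
reduction*): with `B` a bound for `|heightProfile'|`, `A = 4MB + 2M`, `s` the speed of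
`kerr_far_finite_speed_of_propagation` and `R₀` the radius of the fact, put
`λ = max (max (max (4A) (4Ms)) R_far) (max R₀ R)` and `F = heightFn M λ` (admissible, slope `≤ 1/4`,
`F = 0` on `{‖y‖ ≤ λ}`, `0 ≤ sF ≤ ‖y‖/2`). For an admissible wave `φ` with data supported in
`{‖x⃗‖ ≤ ρ}`, `ρ ≥ R_far`, finite speed of propagation makes `φ, dφ` vanish on
`{x⁰ ≥ 0, ‖x⃗‖ > ρ + s x⁰}`; hence `φ` has compactly supported data on the graph of `F` and vanishes
on the wedge `{0 ≤ x⁰ ≤ F(x⃗)}` beyond `‖x⃗‖ = 2ρ + 1`, and the far `J^T` identity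
(`kerr_far_TEnergy_comparison_of_farRadius_le`) gives `E^far_F[φ](0) ≤ 8 E^far_0[φ](0) ≤
8 sliceEnergy φ 0`. Applied to `φ = ψ` and `φ = Tψ` (`IsAdmissibleKerrWave.timeDeriv`), together
with `sliceEnergy ψ 0 ≤ 4 E₂[ψ](0)`, `sliceEnergy (Tψ) 0 ≤ 4 E₂[ψ](0)` and monotonicity of `E₂` in
the region, the right-hand side of the fact is at most `65 E₂[ψ](0)`; its left-hand side is the
target's since `R ≤ λ`. Constant `65 C`, depending only on `(M, a, R)`. This is the argument of
Dafermos–Rodnianski for Prop. 4.6.1 of arXiv:1010.5132, §4.6 ("extending initial data, an easy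
domain of dependence argument, and the fact that `T` is timelike … near infinity"), run for `ψ`
and `Tψ`. [cite: DafermosRodnianski2010KerrSmallA, §4.6 Prop. 4.6.1] -/
theorem drsr_wave_integrated_decay_kerr_of_DRSR
    (h25 : DafermosRodnianskiShlapentokhRothman2016_integratedDecay) :
    drsr_wave_integrated_decay_kerr := by
  obtain ⟨s, hs1, hCfar⟩ := kerr_far_finite_speed_of_propagation
  have hs0 : 0 ≤ s := zero_le_one.trans hs1
  intro instF instS M a hMa R
  have hM : 0 < M := hMa.pos
  obtain ⟨R₀, -, h25'⟩ := h25 M a hMa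
  -- ### the height function and its scale
  obtain ⟨B, hB0, hBd⟩ := exists_bound_deriv_heightProfile
  set A : ℝ := 4 * M * B + 2 * M with hA_def
  have hA0 : 0 ≤ A := by positivity
  set l : ℝ := max (max (max (4 * A) (4 * M * s)) (Kerr.farRadius M a)) (max R₀ R) with hl_def
  have hl_A : 4 * A ≤ l := ((le_max_left _ _).trans (le_max_left _ _)).trans (le_max_left _ _)
  have hl_s : 4 * M * s ≤ l :=
    ((le_max_right _ _).trans (le_max_left _ _)).trans (le_max_left _ _)
  have hl_far : Kerr.farRadius M a ≤ l := (le_max_right _ _).trans (le_max_left _ _)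
  have hl_R₀ : R₀ ≤ l := (le_max_left _ _).trans (le_max_right _ _)
  have hl_R : R ≤ l := (le_max_right _ _).trans (le_max_right _ _)
  have hl_af : Kerr.afRadius a (Kerr.rPlus M a) < l :=
    (Kerr.afRadius_lt_farRadius M a).trans_le hl_far
  have hl : 0 < l := (Kerr.farRadius_pos M a).trans_le hl_far
  set F : E3 → ℝ := heightFn M l with hF_def
  have hF_smooth : ContDiff ℝ ∞ F := contDiff_heightFn M l
  have hF_C1 : ContDiff ℝ 1 F := hF_smooth.of_le (ENat.natCast_le_of_coe_top_le_withTop le_rfl 1)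
  have hF_slope : ∀ y : E3, ‖fderiv ℝ F y‖ ≤ 1 / 4 := by
    intro y
    have h := norm_fderiv_heightFn_le_div hM.le hl hB0 hBd y
    have h2 : A / l ≤ 1 / 4 := by
      rw [div_le_iff₀ hl]; linarith
    rw [← hA_def] at h
    linarith
  have hF_zero : ∀ y : E3, ‖y‖ ≤ l → F y = 0 := fun y hy ↦ heightFn_of_norm_le hl hy
  have hF_nonneg : ∀ y : E3, 0 ≤ F y := heightFn_nonneg hM.le l
  have hF_sF : ∀ y : E3, s * F y ≤ ‖y‖ / 2 := by
    intro y
    have h := heightFn_le hM.le hl y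
    have h1 : s * F y ≤ s * (2 * M * ‖y‖ / l) := mul_le_mul_of_nonneg_left h hs0
    have h2 : s * (2 * M * ‖y‖ / l) ≤ ‖y‖ / 2 := by
      rw [← mul_div_assoc, div_le_div_iff₀ hl (by norm_num : (0:ℝ) < 2)]
      nlinarith [norm_nonneg y]
    exact h1.trans h2
  have hF_adm : Kerr.IsAdmissibleHeight M F :=
    ⟨hF_smooth, ⟨3 / 4, by norm_num, fun y ↦ by linarith [hF_slope y]⟩, _,
      tendsto_heightFn_sub_log hl⟩
  have hzero_C1 : ContDiff ℝ 1 (0 : E3 → ℝ) := contDiff_const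
  have hzero_slope : ∀ y : E3, ‖fderiv ℝ (0 : E3 → ℝ) y‖ ≤ 1 / 4 := by
    intro y; simp
  -- ### the printed theorem for the graph of `F`, flat on `{‖y‖ ≤ λ}`, with its constant
  obtain ⟨C, hC, h25ψ⟩ := h25' F l hF_adm hl_R₀ hF_zero R hl_R
  -- ### KEY: an admissible wave has compactly supported data on the graph of `F`, and its
  -- energy through the far part of the graph is at most `8 ×` its energy through `{t* = 0}`
  have key : ∀ φ : Kerr.exterior M a → ℝ, IsAdmissibleKerrWave M a φ →
      IsAdmissibleKerrWaveOn M a F φ ∧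
        graphSliceEnergyOn (Kerr.exterior M a) φ F 0 {y | l < ‖y‖} ≤
          8 * sliceEnergy (Kerr.exterior M a) φ 0 := by
    intro φ hφ
    obtain ⟨hsmooth, hsol, K, hK, hdata⟩ := hφ
    obtain ⟨ρ₀, -, hρ₀⟩ := exists_spatialNorm_le_of_isCompact hK
    set ρ : ℝ := max ρ₀ (Kerr.farRadius M a) with hρ_def
    have hρfar : Kerr.farRadius M a ≤ ρ := le_max_right _ _
    have hρ0 : 0 ≤ ρ := (Kerr.farRadius_pos M a).le.trans hρfar
    have hρ : ∀ x ∈ K, E4.spatialNorm (x : E4) ≤ ρ := fun x hx ↦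
      (hρ₀ x hx).trans (le_max_left _ _)
    -- finite speed of propagation (far region, speed `s`)
    have hvan : ∀ x : Kerr.exterior M a, 0 ≤ (x : E4) 0 →
        ρ + s * (x : E4) 0 < E4.spatialNorm (x : E4) →
        φ x = 0 ∧ mfderiv 𝓘(ℝ, E4) 𝓘(ℝ, ℝ) φ x = 0 := by
      refine hCfar M a hMa φ hsmooth hsol ρ hρfar fun x hx0 hxρ ↦ hdata x hx0 fun hxK ↦ ?_
      exact absurd (hρ x hxK) (not_le.mpr hxρ)
    -- `φ` has compactly supported data on the graph of `F`
    have hφF : IsAdmissibleKerrWaveOn M a F φ := by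
      refine ⟨hsmooth, hsol, ?_⟩
      set B₂ : Set E4 := (fun y : E3 ↦ E4.ofTimeSpace (F y) y) '' {y | l ≤ ‖y‖ ∧ ‖y‖ ≤ 2 * ρ}
        with hB₂_def
      have hB₂c : IsCompact B₂ := by
        refine IsCompact.image ?_ ?_
        · have : {y : E3 | l ≤ ‖y‖ ∧ ‖y‖ ≤ 2 * ρ} =
              {y | l ≤ ‖y‖} ∩ Metric.closedBall 0 (2 * ρ) := by
            ext y; simp [Metric.mem_closedBall, dist_zero_right]
          rw [this]
          exact (isCompact_closedBall _ _).inter_left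
            (isClosed_le continuous_const continuous_norm)
        · exact E4.continuous_ofTimeSpace' hF_smooth.continuous continuous_id
      have hB₂sub : B₂ ⊆ (Kerr.exterior M a : Set E4) := by
        rintro _ ⟨y, ⟨hy1, _⟩, rfl⟩
        exact Kerr.ofTimeSpace_mem_exterior_iff.mpr
          (Kerr.mem_slice_of_lt_norm (hl_af.trans_le hy1))
      set K' : Set (Kerr.exterior M a) := K ∪ Subtype.val ⁻¹' B₂ with hK'_def
      have hK'c : IsCompact K' := by
        refine hK.union ?_
        have hrange : B₂ ⊆ Set.range (Subtype.val : Kerr.exterior M a → E4) :=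
          fun x hx ↦ ⟨⟨x, hB₂sub hx⟩, rfl⟩
        rw [Topology.IsEmbedding.subtypeVal.isCompact_iff, Set.image_preimage_eq_of_subset hrange]
        exact hB₂c
      refine ⟨K', hK'c, fun x hx0 hxK' ↦ ?_⟩
      set y : E3 := E4.spatial (x : E4) with hy_def
      have hxy : (x : E4) = E4.ofTimeSpace (F y) y := by rw [← hx0]; exact eq_ofTimeSpace _
      have hsn : E4.spatialNorm (x : E4) = ‖y‖ := rfl
      by_cases hfar : 2 * ρ < ‖y‖
      · refine hvan x (hx0 ▸ hF_nonneg y) ?_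
        rw [hsn, hx0]
        have hh := hF_sF y
        nlinarith [hF_nonneg y]
      · push Not at hfar
        by_cases hnear : l ≤ ‖y‖
        · exact absurd (Or.inr ⟨y, ⟨hnear, hfar⟩, hxy.symm⟩ : x ∈ K') hxK'
        · push Not at hnear
          have h0 : (x : E4) 0 = 0 := by rw [hx0, hF_zero y hnear.le]
          exact hdata x h0 fun hxK ↦ hxK' (Or.inl hxK)
    refine ⟨hφF, ?_⟩
    -- the far `J^T` identity between the leaf `{t* = 0}` and the graph of `F` (a theorem)
    have hB := kerr_far_TEnergy_comparison_of_farRadius_le hMa hl_far (F₁ := 0) (F₂ := F)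
      hzero_C1 hF_C1 hzero_slope hF_slope (fun y hy ↦ by simp [hF_zero y hy])
      (fun y ↦ by simpa using hF_nonneg y) φ 0 hsmooth hsol
      ⟨2 * ρ + 1, fun x hx1 hx2 hx3 ↦ by
        simp only [Pi.zero_apply, add_zero] at hx1
        simp only [zero_add] at hx2
        refine hvan x hx1 ?_
        have hsn : E4.spatialNorm (x : E4) = ‖E4.spatial (x : E4)‖ := rfl
        have hh := hF_sF (E4.spatial (x : E4))
        have h2 := mul_le_mul_of_nonneg_left hx2 hs0
        rw [hsn] at hx3 ⊢
        nlinarith⟩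
    calc graphSliceEnergyOn (Kerr.exterior M a) φ F 0 {y | l < ‖y‖}
        ≤ 8 * graphSliceEnergyOn (Kerr.exterior M a) φ 0 0 {y | l < ‖y‖} := hB.1
      _ ≤ 8 * graphSliceEnergy (Kerr.exterior M a) φ 0 0 := by
          gcongr
          exact graphSliceEnergyOn_le _ _ _ _ _
      _ = 8 * sliceEnergy (Kerr.exterior M a) φ 0 := by rw [graphSliceEnergy_zero_height]
  -- ### the constant, and the assembly for `ψ` and `Tψ`
  refine ⟨65 * C, ENNReal.mul_lt_top (by simp) hC, fun ψ hψ ↦ ?_⟩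
  obtain ⟨hψF, hfarψ⟩ := key ψ hψ
  obtain ⟨-, hfarTψ⟩ := key (timeDeriv ψ) (hψ.timeDeriv hM.le)
  set S₂ : ℝ≥0∞ := sliceSobolevEnergy (Kerr.exterior M a) ψ 0 2 0 univ with hS₂_def
  have h1 : sliceSobolevEnergy (Kerr.exterior M a) ψ 0 2 0 (closedBall (0 : E3) l) ≤ S₂ :=
    sliceSobolevEnergy_mono _ _ _ _ _ (subset_univ _)
  have h2 : graphSliceEnergyOn (Kerr.exterior M a) ψ F 0 {y | l < ‖y‖} ≤ 8 * (4 * S₂) :=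
    hfarψ.trans (by
      gcongr
      exact sliceEnergy_le_four_mul_sliceSobolevEnergy _ ψ 0 1)
  have h3 : graphSliceEnergyOn (Kerr.exterior M a) (timeDeriv ψ) F 0 {y | l < ‖y‖} ≤
      8 * (4 * S₂) :=
    hfarTψ.trans (by
      gcongr
      exact sliceEnergy_timeDeriv_le_four_mul_sliceSobolevEnergy hψ.contMDiff 0 0)
  calc ∫⁻ τ in Ioi (0 : ℝ), localSliceEnergy (Kerr.exterior M a) ψ τ R
      ≤ C * (sliceSobolevEnergy (Kerr.exterior M a) ψ 0 2 0 (closedBall (0 : E3) l) +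
          graphSliceEnergyOn (Kerr.exterior M a) ψ F 0 {y | l < ‖y‖} +
          graphSliceEnergyOn (Kerr.exterior M a) (timeDeriv ψ) F 0 {y | l < ‖y‖}) := h25ψ ψ hψF
    _ ≤ C * (S₂ + 8 * (4 * S₂) + 8 * (4 * S₂)) := by gcongr
    _ = 65 * C * S₂ := by ring

/-- **gr.S24 local energy decay from the printed Theorem 3.2 alone**: DRSR Thm. 3.2 (25) for
admissible hypersurfaces (`DafermosRodnianskiShlapentokhRothman2016_integratedDecay`) implies the
qualitative statement `drsr_wave_local_energy_decay_kerr` of `BlackHoles.lean` (`E_loc(τ, R) → 0`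
as `τ → ∞` for every admissible wave and every `R`), through `drsr_wave_integrated_decay_kerr`
(`drsr_wave_integrated_decay_kerr_of_DRSR`) and the classical passage from integrated to
pointwise-in-time local energy decay (`drsr_wave_local_energy_decay_kerr_of_integrated_decay`,
`KerrLocalEnergyDecay.lean`: integrated decay for `ψ` and `Tψ` plus the local energy inequality in
time). This route avoids Corollary 3.1 and the `r^p` method entirely. DRSR, arXiv:1402.7034,
Thm. 3.2 (25), §3.3. [cite: DafermosRodnianskiShlapentokhrothman2014, Thm. 3.2 (25) with §3.3 (p. 14)] -/
theorem drsr_wave_local_energy_decay_kerr_of_DRSR25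
    (h25 : DafermosRodnianskiShlapentokhRothman2016_integratedDecay) :
    drsr_wave_local_energy_decay_kerr :=
  drsr_wave_local_energy_decay_kerr_of_integrated_decay (drsr_wave_integrated_decay_kerr_of_DRSR h25)

end Literature.Geometry.Lorentzian

end
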